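/-
Copyright (c) 2026. All rights reserved.
Released under Apache 2.0 license as described in the file LICENSE.
Authors: hodgecm-mathlib cell (D-0151), fan A, seat A-p10.
-/
import Literature.RepresentationTheory.HeisenbergGroup.SymplecticAbelianizationRing
import Literature.RepresentationTheory.HeisenbergGroup.SchrodingerPiGeneration
import Literature.NumberTheory.Automorphic.AdeleRingSymplecticGeneration
import Literature.NumberTheory.Automorphic.StrongApproximationSLn
import Mathlib.NumberTheory.NumberField.AdeleRing
import HarnessLib

/-!
# `Sp_{2l}(𝐀_F)` has no characters: the adelic symplectic group of a number field is perfect as an abstract group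

Topic `NumberTheory/Automorphic`; namespace `Literature.NumberTheory.Automorphic` (continuation of
`AdeleRingSymplecticGeneration` and `StrongApproximationSLn`).  KERNEL ONLY: theorems; no definition, no named fact, no
instance, no `sorry`.

[Weil1964, Chap. III n° 37–43] works with the adelic symplectic group `Sp(X_A)` of a number field and its metaplectic
cover; [MoeglinVignerasWaldspurger1987, Chap. 2 II.1 (B)] records that two homomorphisms into the metaplectic group over
the same map to `Sp` differ by a CHARACTER of the source, so that uniqueness statements («`M` est unique à un scalaire
près», the splitting over rational points, the identification of two lifts of one embedding) reduce to the absence of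
characters of the source group.  For the FULL adelic group this absence is the present file:

* **`hom_eq_one_adeleRing`** — for a number field `F` and a finite index type `l`, every homomorphism
  `χ : Sp_{2l}(𝐀_F) →* A` to a commutative group is trivial (`Sp_{2l}(𝐀_F) =` Mathlib's
  `Matrix.symplecticGroup l (AdeleRing (𝓞 F) F)`; NO continuity is assumed — the statement is about the abstract group);
  `hom_eq_one_apply_adeleRing`; **`commutator_symplecticGroup_adeleRing_eq_top`** (`Sp_{2l}(𝐀_F)` is perfect);
  `hom_eq_one_of_surjective_adeleRing`, `commutator_eq_top_of_surjective_adeleRing` (through any surjection);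
* the coordinate-free carrier of the tree's adelic metaplectic group (`adelicMpCont.proj` lands in
  `symplecticGroup (polar (adelicForm F ι T))`, `adelicForm F ι T = Matrix.toLinearMap₂' 𝐀_F T` by `rfl`):
  **`monoidHom_symplecticGroup_adeleRing_gram_eq_one`** and `commutator_symplecticGroup_adeleRing_gram_eq_top` for
  `symplecticGroup (polar (Matrix.toLinearMap₂' (AdeleRing (𝓞 F) F) T))`, `det T` a unit, along the tree's surjection
  `transportSp T hT` (`transportSp_surjective`);
* the same for the finite adele ring `𝐀_F^∞ = FiniteAdeleRing (𝓞 F) F` and the infinite adele ring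
  `F_∞ = InfiniteAdeleRing F` (`hom_eq_one_finiteAdeleRing`, `hom_eq_one_infiniteAdeleRing`, and the commutator forms);
* the input **`AdeleRing.exists_isUnit_pivot`** (row reduction with a unit pivot over `𝐀_F = F_∞ × 𝐀_F^∞`: place by
  place, the tree's `FiniteAdeleRing.exists_isUnit_pivot` at the finite places and the field case at the infinite ones),
  whence **`AdeleRing.specialLinearGroup_eq_top_of_transvection_mem`**: every subgroup of `SL_l(𝐀_F)` containing all
  transvections is everything (the tree's `SLnElementary.eq_top_of_transvection_mem`).

PROOF.  The ring form of Folland's Prop. (4.21) (`SymplecticAbelianizationRing.hom_eq_one_of_bigCellReachable`: any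
commutative ring with `2, 3` units, the big-cell shift property and elementary generation of `SL_l`) applied to
`R = 𝐀_F`: `2, 3 ∈ Fˣ ⊂ 𝐀_Fˣ`; the big-cell shift property is the tree's `bigCellReachable_adeleRing`
(`AdeleRingSymplecticGeneration`, from local rings through products and restricted products); elementary generation of
`SL_l(𝐀_F)` is §1.

USE (cell `hodgecm-mathlib`, FLOOR-0 P4, ENGINE E-2 child `Cruxes/H413/Lines/F0_E2SiegelWeilWeilRange.lean`, stub
`stub_SW0_diagChar`, road (α) of record, piece SW0a): the comparison character `C : Sp(𝕎)(𝐀_F) →* ℂˣ` between the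
doubled-diagonal metaplectic lift and `M_g ⊠ M̄_g` (piece SW0b) is trivial by `hom_eq_one_adeleRing` /
`monoidHom_symplecticGroup_adeleRing_gram_eq_one`, in the hypothesis shape `(hH : ∀ χ : H →* ℂˣ, χ = 1)` of the tree's
`Weil1964/AdelicMetaplecticRationalSectionUnique :: adelicMpCont.eq_of_proj_eq_of_forall_hom_eq_one` — with no continuity
or density argument («`Sp(𝕎)(𝐀_F)` is perfect» replaces «local continuous sections + finite-support density»).  HC_CM is
proved only modulo the printed citations until rung 0 closes.

## References
* [Weil1964] A. Weil, *Sur certains groupes d'opérateurs unitaires*, Acta Math. 111 (1964) 143–211, Chap. III n° 37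
  (the adelic groups `Sp(X_A)`, `Mp(X_A)` as restricted products), n° 40–43.
* [MoeglinVignerasWaldspurger1987] C. Mœglin, M.-F. Vignéras, J.-L. Waldspurger, LNM 1291 (1987), Chap. 2 II.1 (B)
  (two lifts differ by a character; uniqueness from perfectness), II.5.
* [Folland1989] G. B. Folland, *Harmonic Analysis in Phase Space* (1989), §4.1 Prop. (4.21).
* [PlatonovRapinchuk1994] V. Platonov, A. Rapinchuk, *Algebraic groups and number theory* (1994), §7.4 (elementary
  matrices in `SL_n` over adele rings; strong approximation).
* [Bump1997] D. Bump, *Automorphic forms and representations* (1997), Thm. 3.3.1 and its proof (row reduction in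
  `SL_n` over the adeles).
-/

noncomputable section

open Matrix NumberField IsDedekindDomain
open scoped MatrixGroups

namespace Literature.NumberTheory.Automorphic

open Literature.RepresentationTheory.HeisenbergGroup
open Literature.RepresentationTheory.HeisenbergGroup.SymplecticMatrix

/-! ## §0 Unit pivots over local rings, products and the adele ring -/

section Pivot

/-- **Unit pivots over a local ring** (in particular a field): for a unimodular column `a` (`∑ c_i a_i = 1`) there are
`t_i` with `a_p + ∑_i t_i a_i` a unit (`p` the distinguished last index) — if `a_p` is a unit take `t = 0`, otherwise
some `a_i` is a unit (not all `c_i a_i` lie in the maximal ideal) and `t_i = (1 - a_p) a_i⁻¹` makes the entry `1`.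
[folklore] -/
private theorem exists_isUnit_pivot_of_isLocalRing {R : Type*} [CommRing R] [IsLocalRing R] {r : ℕ}
    (a c : Fin r ⊕ Unit → R) (hca : ∑ i, c i * a i = 1) :
    ∃ t : Fin r → R, IsUnit (a (Sum.inr ()) + ∑ i, t i * a (Sum.inl i)) := by
  classical
  by_cases hp : IsUnit (a (Sum.inr ()))
  · exact ⟨0, by simpa using hp⟩
  · -- some `a (inl i)` is a unit
    have hex : ∃ i : Fin r, IsUnit (a (Sum.inl i)) := by
      by_contra hne
      have hne : ∀ i : Fin r, ¬IsUnit (a (Sum.inl i)) := fun i h => hne ⟨i, h⟩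
      have hmem : ∀ i, c i * a i ∈ IsLocalRing.maximalIdeal R := by
        rintro (i | ⟨⟩)
        · exact Ideal.mul_mem_left _ _ ((IsLocalRing.mem_maximalIdeal _).2 (hne i))
        · exact Ideal.mul_mem_left _ _ ((IsLocalRing.mem_maximalIdeal _).2 hp)
      have h1 : (1 : R) ∈ IsLocalRing.maximalIdeal R := by
        rw [← hca]; exact Submodule.sum_mem _ fun i _ => hmem i
      exact (IsLocalRing.maximalIdeal.isMaximal R).ne_top (Ideal.eq_top_of_isUnit_mem _ h1 isUnit_one)
    obtain ⟨i, hi⟩ := hex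
    refine ⟨Function.update 0 i ((1 - a (Sum.inr ())) * ((hi.unit⁻¹ : Rˣ) : R)), ?_⟩
    rw [Finset.sum_eq_single i (fun j _ hj => by rw [Function.update_of_ne hj, Pi.zero_apply, zero_mul])
      (fun h => (h (Finset.mem_univ i)).elim), Function.update_self, mul_assoc, IsUnit.val_inv_mul, mul_one,
      add_sub_cancel]
    exact isUnit_one

/-- **Unit pivots pass to products `Π i, R i`**: the multipliers are chosen componentwise (a unit of a product is a
family of units, Mathlib `Pi.isUnit_iff`). [folklore] -/
private theorem exists_isUnit_pivot_pi {ι : Type*} {P : ι → Type*} [∀ i, CommRing (P i)]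
    (hP : ∀ (i : ι) (r : ℕ) (a c : Fin r ⊕ Unit → P i), ∑ k, c k * a k = 1 →
      ∃ t : Fin r → P i, IsUnit (a (Sum.inr ()) + ∑ k, t k * a (Sum.inl k)))
    {r : ℕ} (a c : Fin r ⊕ Unit → ∀ i, P i) (hca : ∑ k, c k * a k = 1) :
    ∃ t : Fin r → ∀ i, P i, IsUnit (a (Sum.inr ()) + ∑ k, t k * a (Sum.inl k)) := by
  have hloc : ∀ i, ∃ t : Fin r → P i, IsUnit (a (Sum.inr ()) i + ∑ k, t k * a (Sum.inl k) i) := by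
    intro i
    refine hP i r (fun k => a k i) (fun k => c k i) ?_
    have h := congrFun hca i
    simpa only [Finset.sum_apply, Pi.mul_apply, Pi.one_apply] using h
  choose t ht using hloc
  refine ⟨fun k i => t i k, ?_⟩
  rw [Pi.isUnit_iff]
  intro i
  simpa only [Pi.add_apply, Finset.sum_apply, Pi.mul_apply] using ht i

/-- **Unit pivots pass to binary products `R × S`** (Mathlib `Prod.isUnit_iff`). [folklore] -/
private theorem exists_isUnit_pivot_prod {R S : Type*} [CommRing R] [CommRing S]
    (hR : ∀ (r : ℕ) (a c : Fin r ⊕ Unit → R), ∑ k, c k * a k = 1 →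
      ∃ t : Fin r → R, IsUnit (a (Sum.inr ()) + ∑ k, t k * a (Sum.inl k)))
    (hS : ∀ (r : ℕ) (a c : Fin r ⊕ Unit → S), ∑ k, c k * a k = 1 →
      ∃ t : Fin r → S, IsUnit (a (Sum.inr ()) + ∑ k, t k * a (Sum.inl k)))
    {r : ℕ} (a c : Fin r ⊕ Unit → R × S) (hca : ∑ k, c k * a k = 1) :
    ∃ t : Fin r → R × S, IsUnit (a (Sum.inr ()) + ∑ k, t k * a (Sum.inl k)) := by
  have h1 : ∑ k, (c k).1 * (a k).1 = 1 := by
    have h := congrArg Prod.fst hca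
    simpa only [Prod.fst_sum, Prod.fst_mul, Prod.fst_one] using h
  have h2 : ∑ k, (c k).2 * (a k).2 = 1 := by
    have h := congrArg Prod.snd hca
    simpa only [Prod.snd_sum, Prod.snd_mul, Prod.snd_one] using h
  obtain ⟨t₁, ht₁⟩ := hR r (fun k => (a k).1) (fun k => (c k).1) h1
  obtain ⟨t₂, ht₂⟩ := hS r (fun k => (a k).2) (fun k => (c k).2) h2
  refine ⟨fun k => (t₁ k, t₂ k), ?_⟩
  rw [Prod.isUnit_iff]
  constructor
  · simpa only [Prod.fst_add, Prod.fst_sum, Prod.fst_mul] using ht₁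
  · simpa only [Prod.snd_add, Prod.snd_sum, Prod.snd_mul] using ht₂

variable (F : Type*) [Field F] [NumberField F]

omit [NumberField F] in
/-- **Row reduction over the infinite adele ring `F_∞ = ∏_{v ∣ ∞} F_v`** (a finite product of fields): a unimodular
column acquires a unit pivot by row operations. [cite: Bump1997, Thm. 3.3.1 (proof)] [cite: PlatonovRapinchuk1994, §7.4] -/
theorem InfiniteAdeleRing.exists_isUnit_pivot {r : ℕ} (a c : Fin r ⊕ Unit → InfiniteAdeleRing F)
    (hca : ∑ k, c k * a k = 1) :
    ∃ t : Fin r → InfiniteAdeleRing F, IsUnit (a (Sum.inr ()) + ∑ k, t k * a (Sum.inl k)) :=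
  exists_isUnit_pivot_pi (P := fun v : InfinitePlace F => v.Completion)
    (fun v _ a c hca => exists_isUnit_pivot_of_isLocalRing (R := v.Completion) a c hca) a c hca

/-- **Row reduction over the adele ring `𝐀_F = F_∞ × 𝐀_F^∞`**: for a unimodular column `a` (`∑ c_k a_k = 1`) there are
adeles `t_k` with `a_p + ∑_k t_k a_k` a unit — the infinite places by the field case, the finite adeles by the tree's
`FiniteAdeleRing.exists_isUnit_pivot` (place by place; where the column is integral unimodularity forces a unit entry).
[cite: Bump1997, Thm. 3.3.1 (proof)] [cite: PlatonovRapinchuk1994, §7.4 Thm. 7.12] -/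
theorem AdeleRing.exists_isUnit_pivot {r : ℕ} (a c : Fin r ⊕ Unit → AdeleRing (𝓞 F) F)
    (hca : ∑ k, c k * a k = 1) :
    ∃ t : Fin r → AdeleRing (𝓞 F) F, IsUnit (a (Sum.inr ()) + ∑ k, t k * a (Sum.inl k)) :=
  exists_isUnit_pivot_prod (fun _ a c hca => InfiniteAdeleRing.exists_isUnit_pivot F a c hca)
    (fun _ a c hca => FiniteAdeleRing.exists_isUnit_pivot (R := 𝓞 F) (K := F) a c hca) a c hca

variable {l : Type*} [DecidableEq l] [Fintype l]

/-- **`SL_l(𝐀_F)` is generated by elementary matrices**, in the strong form: every subgroup of `SL_l(𝐀_F)` containing all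
transvections `1 + c E_{ij}` is everything (the tree's `SLnElementary.eq_top_of_transvection_mem` over
`AdeleRing.exists_isUnit_pivot`). [cite: PlatonovRapinchuk1994, §7.4 Thm. 7.12] [cite: Bump1997, Thm. 3.3.1 (proof)] -/
theorem AdeleRing.specialLinearGroup_eq_top_of_transvection_mem (H : Subgroup (Matrix.SpecialLinearGroup l (AdeleRing (𝓞 F) F)))
    (hH : ∀ (i j : l) (hij : i ≠ j) (c : AdeleRing (𝓞 F) F), Matrix.SpecialLinearGroup.transvection hij c ∈ H) :
    H = ⊤ :=
  SLnElementary.eq_top_of_transvection_mem (fun _ a c hca => AdeleRing.exists_isUnit_pivot F a c hca) H hH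

omit [NumberField F] in
/-- The same over the infinite adele ring `F_∞`. [cite: PlatonovRapinchuk1994, §7.4] -/
theorem InfiniteAdeleRing.specialLinearGroup_eq_top_of_transvection_mem
    (H : Subgroup (Matrix.SpecialLinearGroup l (InfiniteAdeleRing F)))
    (hH : ∀ (i j : l) (hij : i ≠ j) (c : InfiniteAdeleRing F), Matrix.SpecialLinearGroup.transvection hij c ∈ H) :
    H = ⊤ :=
  SLnElementary.eq_top_of_transvection_mem (fun _ a c hca => InfiniteAdeleRing.exists_isUnit_pivot F a c hca) H hH

/-- The same over the finite adele ring `𝐀_F^∞` (the tree's pivot lemma verbatim). [cite: PlatonovRapinchuk1994, §7.4 Thm. 7.12] -/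
theorem FiniteAdeleRing.specialLinearGroup_eq_top_of_transvection_mem
    (H : Subgroup (Matrix.SpecialLinearGroup l (FiniteAdeleRing (𝓞 F) F)))
    (hH : ∀ (i j : l) (hij : i ≠ j) (c : FiniteAdeleRing (𝓞 F) F), Matrix.SpecialLinearGroup.transvection hij c ∈ H) :
    H = ⊤ :=
  SLnElementary.eq_top_of_transvection_mem
    (fun _ a c hca => FiniteAdeleRing.exists_isUnit_pivot (R := 𝓞 F) (K := F) a c hca) H hH

end Pivot

/-! ## §1 `2` and `3` are adelic units -/

section Units

variable (F : Type*) [Field F] [NumberField F]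

omit [NumberField F] in
omit [NumberField F] in
/-- `2 ∈ Fˣ` is a unit of any `F`-algebra (`char F = 0`). [folklore] -/
private theorem isUnit_two_of_algebra [CharZero F] (S : Type*) [CommRing S] [Algebra F S] : IsUnit (2 : S) := by
  have h : IsUnit (2 : F) := isUnit_iff_ne_zero.2 two_ne_zero
  simpa only [map_ofNat] using h.map (algebraMap F S)

omit [NumberField F] in
/-- `3 ∈ Fˣ` is a unit of any `F`-algebra (`char F = 0`). [folklore] -/
private theorem isUnit_three_of_algebra [CharZero F] (S : Type*) [CommRing S] [Algebra F S] : IsUnit (3 : S) := by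
  have h : IsUnit (3 : F) := isUnit_iff_ne_zero.2 three_ne_zero
  simpa only [map_ofNat] using h.map (algebraMap F S)

/-- **`2 ∈ 𝐀_Fˣ`** (`2 ∈ Fˣ` embedded diagonally). [cite: Weil1964, Chap. III n° 37] -/
theorem AdeleRing.isUnit_two : IsUnit (2 : AdeleRing (𝓞 F) F) := isUnit_two_of_algebra F _

/-- **`3 ∈ 𝐀_Fˣ`**. [cite: Weil1964, Chap. III n° 37] -/
theorem AdeleRing.isUnit_three : IsUnit (3 : AdeleRing (𝓞 F) F) := isUnit_three_of_algebra F _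

omit [NumberField F] in
/-- `2 ∈ F_∞ˣ`. [cite: Weil1964, Chap. III n° 37] -/
theorem InfiniteAdeleRing.isUnit_two [CharZero F] : IsUnit (2 : InfiniteAdeleRing F) := isUnit_two_of_algebra F _

omit [NumberField F] in
/-- `3 ∈ F_∞ˣ`. [cite: Weil1964, Chap. III n° 37] -/
theorem InfiniteAdeleRing.isUnit_three [CharZero F] : IsUnit (3 : InfiniteAdeleRing F) :=
  isUnit_three_of_algebra F _

/-- `2 ∈ (𝐀_F^∞)ˣ`. [cite: Weil1964, Chap. III n° 37] -/
theorem FiniteAdeleRing.isUnit_two : IsUnit (2 : FiniteAdeleRing (𝓞 F) F) := isUnit_two_of_algebra F _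

/-- `3 ∈ (𝐀_F^∞)ˣ`. [cite: Weil1964, Chap. III n° 37] -/
theorem FiniteAdeleRing.isUnit_three : IsUnit (3 : FiniteAdeleRing (𝓞 F) F) := isUnit_three_of_algebra F _

end Units

/-! ## §2 `Sp_{2l}(𝐀_F)` has no characters -/

section Adelic

variable {l : Type*} [DecidableEq l] [Fintype l] (F : Type*) [Field F] [NumberField F] {A : Type*} [CommGroup A]

/-- **Every homomorphism `Sp_{2l}(𝐀_F) →* A` to a commutative group is trivial** — the adelic symplectic group of a
number field has no characters AS AN ABSTRACT GROUP (no continuity assumed): Folland's Prop. (4.21) in ring form over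
`R = 𝐀_F` (`2, 3 ∈ 𝐀_Fˣ`, big-cell shift `bigCellReachable_adeleRing`, elementary generation of `SL_l(𝐀_F)`).
[cite: MoeglinVignerasWaldspurger1987, Chap. 2 II.1 (B)] [cite: Folland1989, §4.1 Prop. (4.21)] [cite: Weil1964, Chap. III n° 37] -/
theorem hom_eq_one_adeleRing (χ : Matrix.symplecticGroup l (AdeleRing (𝓞 F) F) →* A) : χ = 1 :=
  hom_eq_one_of_bigCellReachable (bigCellReachable_adeleRing F) (AdeleRing.isUnit_two F) (AdeleRing.isUnit_three F)
    (AdeleRing.specialLinearGroup_eq_top_of_transvection_mem F) χ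

/-- Pointwise form: `χ g = 1`. [cite: MoeglinVignerasWaldspurger1987, Chap. 2 II.1 (B)] -/
theorem hom_eq_one_apply_adeleRing (χ : Matrix.symplecticGroup l (AdeleRing (𝓞 F) F) →* A)
    (g : Matrix.symplecticGroup l (AdeleRing (𝓞 F) F)) : χ g = 1 := by
  rw [hom_eq_one_adeleRing F χ, MonoidHom.one_apply]

/-- **`Sp_{2l}(𝐀_F)` is perfect**: `commutator Sp_{2l}(𝐀_F) = ⊤`.
[cite: MoeglinVignerasWaldspurger1987, Chap. 2 II.1 (B)] [cite: Folland1989, §4.1 Prop. (4.21)] -/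
theorem commutator_symplecticGroup_adeleRing_eq_top :
    commutator (Matrix.symplecticGroup l (AdeleRing (𝓞 F) F)) = ⊤ :=
  commutator_eq_top_of_bigCellReachable (bigCellReachable_adeleRing F) (AdeleRing.isUnit_two F)
    (AdeleRing.isUnit_three F) (AdeleRing.specialLinearGroup_eq_top_of_transvection_mem F)

/-- Through any surjection `π : Sp_{2l}(𝐀_F) ↠ G`: every homomorphism `G →* A` to a commutative group is trivial.
[cite: MoeglinVignerasWaldspurger1987, Chap. 2 II.1 (B)] -/
theorem hom_eq_one_of_surjective_adeleRing {G : Type*} [Group G]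
    (π : Matrix.symplecticGroup l (AdeleRing (𝓞 F) F) →* G) (hπ : Function.Surjective π) (χ : G →* A) : χ = 1 :=
  hom_eq_one_of_surjective_of_bigCellReachable (bigCellReachable_adeleRing F) (AdeleRing.isUnit_two F)
    (AdeleRing.isUnit_three F) (AdeleRing.specialLinearGroup_eq_top_of_transvection_mem F) π hπ χ

/-- Through any surjection `π : Sp_{2l}(𝐀_F) ↠ G`: `G` is perfect. [cite: MoeglinVignerasWaldspurger1987, Chap. 2 II.1 (B)] -/
theorem commutator_eq_top_of_surjective_adeleRing {G : Type*} [Group G]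
    (π : Matrix.symplecticGroup l (AdeleRing (𝓞 F) F) →* G) (hπ : Function.Surjective π) : commutator G = ⊤ :=
  commutator_eq_top_of_surjective_of_bigCellReachable (bigCellReachable_adeleRing F) (AdeleRing.isUnit_two F)
    (AdeleRing.isUnit_three F) (AdeleRing.specialLinearGroup_eq_top_of_transvection_mem F) π hπ

/-- **The finite adele ring**: every homomorphism `Sp_{2l}(𝐀_F^∞) →* A` to a commutative group is trivial.
[cite: MoeglinVignerasWaldspurger1987, Chap. 2 II.1 (B)] [cite: Folland1989, §4.1 Prop. (4.21)] -/
theorem hom_eq_one_finiteAdeleRing (χ : Matrix.symplecticGroup l (FiniteAdeleRing (𝓞 F) F) →* A) : χ = 1 :=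
  hom_eq_one_of_bigCellReachable (bigCellReachable_finiteAdeleRing F) (FiniteAdeleRing.isUnit_two F)
    (FiniteAdeleRing.isUnit_three F) (FiniteAdeleRing.specialLinearGroup_eq_top_of_transvection_mem F) χ

/-- `Sp_{2l}(𝐀_F^∞)` is perfect. [cite: MoeglinVignerasWaldspurger1987, Chap. 2 II.1 (B)] -/
theorem commutator_symplecticGroup_finiteAdeleRing_eq_top :
    commutator (Matrix.symplecticGroup l (FiniteAdeleRing (𝓞 F) F)) = ⊤ :=
  commutator_eq_top_of_bigCellReachable (bigCellReachable_finiteAdeleRing F) (FiniteAdeleRing.isUnit_two F)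
    (FiniteAdeleRing.isUnit_three F) (FiniteAdeleRing.specialLinearGroup_eq_top_of_transvection_mem F)

omit [NumberField F] in
/-- **The infinite adele ring**: every homomorphism `Sp_{2l}(F_∞) →* A` to a commutative group is trivial (`char F = 0`).
[cite: Folland1989, §4.1 Prop. (4.21)] -/
theorem hom_eq_one_infiniteAdeleRing [CharZero F] (χ : Matrix.symplecticGroup l (InfiniteAdeleRing F) →* A) : χ = 1 :=
  hom_eq_one_of_bigCellReachable (bigCellReachable_infiniteAdeleRing F) (InfiniteAdeleRing.isUnit_two F)
    (InfiniteAdeleRing.isUnit_three F) (InfiniteAdeleRing.specialLinearGroup_eq_top_of_transvection_mem F) χ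

omit [NumberField F] in
/-- `Sp_{2l}(F_∞)` is perfect (`char F = 0`). [cite: Folland1989, §4.1 Prop. (4.21)] -/
theorem commutator_symplecticGroup_infiniteAdeleRing_eq_top [CharZero F] :
    commutator (Matrix.symplecticGroup l (InfiniteAdeleRing F)) = ⊤ :=
  commutator_eq_top_of_bigCellReachable (bigCellReachable_infiniteAdeleRing F) (InfiniteAdeleRing.isUnit_two F)
    (InfiniteAdeleRing.isUnit_three F) (InfiniteAdeleRing.specialLinearGroup_eq_top_of_transvection_mem F)

end Adelic

/-! ## §3 The coordinate-free carrier `Sp(W_𝐀, β_T)` of the adelic metaplectic group -/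

section Gram

variable (F : Type*) [Field F] [NumberField F] {ι : Type*} [Fintype ι] [DecidableEq ι]
  (T : Matrix ι ι (AdeleRing (𝓞 F) F)) (hT : IsUnit T.det) {A : Type*} [CommGroup A]

include hT in
/-- **Every homomorphism `Sp(W_𝐀, β_T) →* A` to a commutative group is trivial**, for the coordinate-free adelic
symplectic group `symplecticGroup (polar (Matrix.toLinearMap₂' 𝐀_F T))` of the duality `⟨x, T y⟩` on
`W_𝐀 = 𝐀_F^ι × 𝐀_F^ι`, `det T` a unit — the carrier in which the tree's `adelicMpCont.proj` takes values
(`adelicForm F ι T = Matrix.toLinearMap₂' _ T` by `rfl`): it receives the surjection `transportSp T hT` from the perfect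
group `Sp_{2ι}(𝐀_F)`. [cite: MoeglinVignerasWaldspurger1987, Chap. 2 II.1 (B)] [cite: Weil1964, Chap. III n° 37] -/
theorem monoidHom_symplecticGroup_adeleRing_gram_eq_one
    (χ : symplecticGroup (polar (Matrix.toLinearMap₂' (AdeleRing (𝓞 F) F) T)) →* A) : χ = 1 :=
  hom_eq_one_of_surjective_adeleRing F (transportSp T hT) (transportSp_surjective T hT) χ

include hT in
/-- Pointwise form on the coordinate-free carrier. [cite: MoeglinVignerasWaldspurger1987, Chap. 2 II.1 (B)] -/
theorem monoidHom_symplecticGroup_adeleRing_gram_eq_one_apply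
    (χ : symplecticGroup (polar (Matrix.toLinearMap₂' (AdeleRing (𝓞 F) F) T)) →* A)
    (g : symplecticGroup (polar (Matrix.toLinearMap₂' (AdeleRing (𝓞 F) F) T))) : χ g = 1 := by
  rw [monoidHom_symplecticGroup_adeleRing_gram_eq_one F T hT χ, MonoidHom.one_apply]

include hT in
/-- **`Sp(W_𝐀, β_T)` is perfect.** [cite: MoeglinVignerasWaldspurger1987, Chap. 2 II.1 (B)] -/
theorem commutator_symplecticGroup_adeleRing_gram_eq_top :
    commutator (symplecticGroup (polar (Matrix.toLinearMap₂' (AdeleRing (𝓞 F) F) T))) = ⊤ :=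
  commutator_eq_top_of_surjective_adeleRing F (transportSp T hT) (transportSp_surjective T hT)

include hT in
/-- **Two homomorphisms `s₁, s₂ : H →* Sp(W_𝐀, β_T)`-valued data agree as soon as they differ by a character of a
group without characters** — packaged for the consumer: a homomorphism `c : H →* A` that FACTORS through
`Sp(W_𝐀, β_T)` (`c = C ∘ ι` for some `C : Sp(W_𝐀, β_T) →* A`) is trivial. [cite: MoeglinVignerasWaldspurger1987, Chap. 2 II.1 (B)] -/
theorem monoidHom_eq_one_of_factors_through_symplecticGroup_adeleRing_gram {H : Type*} [Group H]
    (ι' : H →* symplecticGroup (polar (Matrix.toLinearMap₂' (AdeleRing (𝓞 F) F) T)))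
    (C : symplecticGroup (polar (Matrix.toLinearMap₂' (AdeleRing (𝓞 F) F) T)) →* A) (c : H →* A)
    (hc : c = C.comp ι') : c = 1 := by
  rw [hc, monoidHom_symplecticGroup_adeleRing_gram_eq_one F T hT C, MonoidHom.one_comp]

end Gram

end Literature.NumberTheory.Automorphic
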